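import Literature.AnabelianGeometry.SemiGraphs.PSCVertexQuotientConverseProofs
import HarnessLib

/-!
# [IUTchI] Remark 1.2.3 (iv), verticial part: the printed statement `VertexSetCharacterizationHolds Ω`

Mochizuki, *Inter-universal Teichmüller theory I*, Remark 1.2.3 (iv), kurims manuscript p. 42: the
characterization of the vertex quotients `M^unr-vert_G ↠ M^unr_G[v] ⊗ F_l` and "Thus, since `G` is
sturdy, the set of vertices of `G` may be characterized as the set of [nontrivial!] quotients".
abc-iut-L3-t4's typing records the split injection and the criterion as the origin-parametrised
statement `UnrVerticialCharacterizationHolds Ω` and expects the vertex-set description to be DERIVED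
(sub-DAG row T16-L13 of the cell's plan for [CombGC] Thm. 1.6).  With both halves of
`PSCDatum.VertexQuotientCharacterization` proved for data on profinite groups
(`PSCVertexQuotientProofs.lean`, `PSCVertexQuotientNontrivialProofs.lean`,
`PSCVertexQuotientConverseProofs.lean`; seat abc-iut-w4-d052), this proof-only file assembles the
printed statement `VertexSetCharacterizationHolds Ω` for every origin predicate `Ω` whose data live on
profinite (compact, Hausdorff, totally disconnected) groups — from `UnrVerticialCharacterizationHolds Ω`
and `UnrVertAbOfRankHolds Ω` BY NAME (no other input).  Nothing here takes a side on [IUTchIII]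
Cor. 3.12. [cite: Mochizuki2012, IUTchI Rmk 1.2.3(iv) p.42]
-/

noncomputable section

namespace Literature.AnabelianGeometry.SemiGraphs

namespace PSCDatum

universe u

/-- **[IUTchI] Remark 1.2.3 (iv), verticial part, as printed — for profinite origin predicates.**
If every datum of `Ω`-PSC-type lives on a profinite group (as the pro-`Σ` fundamental groups of
[CombGC] Def. 1.1 do), then the split injection and the criterion (`UnrVerticialCharacterizationHolds Ω`)
together with the rank `2·genus(v)` of `M^unr_G[v]` (`UnrVertAbOfRankHolds Ω`) give
`VertexSetCharacterizationHolds Ω`: the characterization of the vertex quotients and "the set of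
vertices of `G` … as the set of [nontrivial!] quotients `M^unr-vert_G ↠ M^unr_G[v] ⊗ F_l`".
[cite: Mochizuki2012, IUTchI Rmk 1.2.3(iv) p.42] -/
theorem vertexSetCharacterizationHolds_of_profiniteOrigin (Ω : PSCOrigin.{u})
    (hΩ : ∀ ⦃Q : Type u⦄ [Group Q] [TopologicalSpace Q] (G : PSCDatum Q),
      Ω.IsOfPSCType G → CompactSpace Q ∧ T2Space Q ∧ TotallyDisconnectedSpace Q)
    (h₁ : UnrVerticialCharacterizationHolds Ω) (h₂ : UnrVertAbOfRankHolds Ω) :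
    VertexSetCharacterizationHolds Ω := by
  intro Q _ _ _ G hG
  obtain ⟨hc, ht, hd⟩ := hΩ G hG
  haveI := hc; haveI := ht; haveI := hd
  exact ⟨G.vertexQuotientCharacterization_of_inputs (h₁ G hG).2 (h₁ G hG).1 (h₂ G hG),
    G.vertexSetCharacterization_of_inputs (h₁ G hG).1 (h₂ G hG)⟩

/-- The same with the weaker-looking profiniteness hypothesis "compact and totally disconnected"
(Hausdorff follows for a topological group). [cite: Mochizuki2012, IUTchI Rmk 1.2.3(iv) p.42] -/
theorem vertexSetCharacterizationHolds_of_compact_totallyDisconnected (Ω : PSCOrigin.{u})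
    (hΩ : ∀ ⦃Q : Type u⦄ [Group Q] [TopologicalSpace Q] [IsTopologicalGroup Q] (G : PSCDatum Q),
      Ω.IsOfPSCType G → CompactSpace Q ∧ TotallyDisconnectedSpace Q)
    (h₁ : UnrVerticialCharacterizationHolds Ω) (h₂ : UnrVertAbOfRankHolds Ω) :
    VertexSetCharacterizationHolds Ω := by
  intro Q _ _ _ G hG
  obtain ⟨hc, hd⟩ := hΩ G hG
  haveI := hc; haveI := hd
  haveI : T2Space Q := inferInstance
  exact ⟨G.vertexQuotientCharacterization_of_inputs (h₁ G hG).2 (h₁ G hG).1 (h₂ G hG),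
    G.vertexSetCharacterization_of_inputs (h₁ G hG).1 (h₂ G hG)⟩

end PSCDatum

end Literature.AnabelianGeometry.SemiGraphs

end
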